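import Literature.AlgebraicGeometry.Morphisms.SectionConormalFreeLocal   -- ★ p844355 (D1b) A-p01 (g22): `exists_chart_isStandardSmoothOfRelativeDimension`, `free_cotangent_sectionAug_of_isStandardSmooth`, …
import Literature.AlgebraicGeometry.Morphisms.SectionConormalHomComp    -- ★-to-be (D2c-i) A-p01 (g22): `sectionConormalEndo_id`, `sectionConormalEndo_eq_of_shrink`, `charpoly_sectionConormalEndo_eq_of_charts`, `free_cotangent_sectionAug_of_chart`
import Mathlib.LinearAlgebra.Charpoly.Basic
import Mathlib.LinearAlgebra.Matrix.Dual
import Mathlib.LinearAlgebra.Charpoly.ToMatrix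
import HarnessLib

/-!
# The cotangent space `ω = e^*Ω¹ = I∕I²` of a section over a LOCAL base, its `End`-action, its dual `Lie`, and the CHARACTERISTIC POLYNOMIAL of an endomorphism fixing the section
# (Görtz–Wedhorn II Def. 27.17 ∕ Rem. 27.18 ∕ Rem. 17.14; Kottwitz 1992 §5 «`det(T − i(b) | Lie A)`»; EGA IV₄ 17.2.3)

Topic `Literature/AlgebraicGeometry/Morphisms`, namespace `Literature.AlgebraicGeometry.Morphisms`.  DEFINITIONS with bodies (`sectionStdChart`, `SectionCotangent`,
`sectionCotangentMap`, `SectionLie`, `sectionLieMap`, `sectionCotangentCharpoly`) + THEOREMS; no instance, no notation, no named fact, no `sorry` (def lane, box-before-file).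
Sequel of ★ `Morphisms/SectionConormalChart` (`ChartRing`, `sectionAug`, `sectionConormalEndo` — the action `γ_v` of an `R`-endomorphism `v` fixing the section on `I∕I²`, read
on a chart through a basic open `D(h) ⊆ W ∩ v⁻¹W`, [GortzWedhorn2023] Rem. 17.14) and of ★ (D1b) `Morphisms/SectionConormalFreeLocal` (over a LOCAL base the whole section lies
in ONE standard-smooth affine chart, on which `I∕I²` is free of rank `n`).  Cell `pub/hodgecm-mathlib` (D-0151), programme P6 «MOD», ROW 3 organ **L3.1 «`Lie(A∕S) =
(e^*Ω¹_{A∕S})ᵛ`»** (kit author A-p07 (g17); socket `LieRealisation A g` of `F0/P6-kit/KottwitzCondition.desk`: `charpoly : (A.X ⟶ A.X) → Γ(S, 𝒪_S)[T]`, monic, degree `g`,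
`charpoly 𝟙 = (T − 1)^g`), brick **(D2a)** of A-p01 (g22)'s census 754bb3cc: the GENERIC construction behind the socket at `S = Spec R`, `R` local — for ANY `f : X → Spec R` smooth
of relative dimension `n` with a section `e` (the abelian-scheme specialisation `f := 𝒜.X.hom`, `e := η[𝒜.X].left` is brick (D2b)).  HONEST LABEL: HC_CM is proved only modulo
the cell's 2 remaining named inputs (hLiu418 24832, h413 24833) until rung 0 closes; this file is unconditional (`--supports stmt-HodgeConjecture-24832`) and pays no letter.

THE CONSTRUCTION (`R` local, `f : X → Spec R` smooth of relative dimension `n`, `e` a section, `he : e ≫ f = 𝟙`).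
* §1 `sectionStdChart f e he n : X.Opens` — a CHOSEN standard-smooth affine chart of the whole section (★ `exists_chart_isStandardSmoothOfRelativeDimension`), with its three
  properties `isAffineOpen_sectionStdChart`, `preimage_sectionStdChart_eq_top`, `isStandardSmoothOfRelativeDimension_chartRing_sectionStdChart`.
* §2 **`SectionCotangent f e he n`** `:= (augIdeal (sectionAug f e he (preimage_sectionStdChart_eq_top …))).Cotangent` — the COTANGENT SPACE `ω_{X∕R,e} = e^*Ω¹_{X∕R} = I∕I²`
  ALONG THE SECTION as an `R`-module: FREE, FINITE, `finrank = n` (★ (D1b)); **`SectionLie f e he n := Module.Dual R (SectionCotangent …)`** — `Lie = (e^*Ω¹)ᵛ`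
  ([GortzWedhorn2023] Def. 27.17), free finite of `finrank = n`.
* §2b (★ D2c-i transport) `free_∕finite_∕finrank_cotangent_sectionAug_of_isLocalRing`: EVERY affine chart of the section over the local base has `I∕I²` free of rank `n`.
* §3 **`sectionCotangentMap f e he n v hv hev : SectionCotangent →ₗ[R] SectionCotangent`** for an `R`-endomorphism `v` of `X` (`hv : v ≫ f = f`) FIXING THE SECTION
  (`hev : e ≫ v = e`) := ★ `sectionConormalEndo` through a CHOSEN basic open `D(h) ⊆ W ∩ v⁻¹W` containing the section (★ `exists_sectionAug_eq_one_and_basicOpen_le`);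
  `sectionCotangentMap_id` (`v = 𝟙 ⇒ id`, by ★ D2c-i `sectionConormalEndo_id`);
  **`sectionLieMap`** `:= dualMap` (the TANGENT map `Lie(v)`, [GortzWedhorn2023] Rem. 27.18 (1)), `sectionLieMap_id`.
* §4 **`sectionCotangentCharpoly f e he n v hv hev : R[X]`** `:= (sectionCotangentMap …).charpoly` — THE THREE SOCKET CLAUSES `monic_sectionCotangentCharpoly`,
  `natDegree_sectionCotangentCharpoly` (`= n`), `sectionCotangentCharpoly_id` (`= (X − C 1)^n`) — and `charpoly_sectionLieMap` (the Lie side has THE SAME characteristic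
  polynomial: transpose, as in the tree's field case ★ `Motives.AbelianVariety.charpoly_lieMap`); the FIBRE comparison is ★ `Motives.AbelianVariety.charpoly_cotangentMap_eq_map_charpoly`
  applied to the `sectionConormalEndo` this file chooses (`sectionCotangentMap_def`, `sectionCotangentCharpoly_eq`).
* §5 `charpoly_sectionConormalEndo_eq_sectionCotangentCharpoly` (ANY affine chart, ANY shrinking element ⇒ the same polynomial).
CHOICES AND THEIR IRRELEVANCE.  The chart `W` and the element `h` are chosen (`Classical.choose`); by ★ (D2c-i) `Morphisms/SectionConormalHomComp` (composition law ∕ chart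
independence) §2b shows that over the local base EVERY affine chart of the section has `I∕I²` free of rank `n` (`free_∕finite_∕finrank_cotangent_sectionAug_of_isLocalRing`), and §5
that `sectionCotangentCharpoly` IS the characteristic polynomial of ★ `sectionConormalEndo` read on ANY affine chart with ANY shrinking element
(`charpoly_sectionConormalEndo_eq_sectionCotangentCharpoly`) — the form F0P6a-plan (g0)'s chart-local typing of the Kottwitz condition reads (CENSUS-P6a v1 §(vi)).
NOT here: base change `R → R'` (brick (D2c-ii)).

## References
* [GortzWedhorn2023] U. Görtz, T. Wedhorn, *Algebraic Geometry II* (2023): Def. 27.17, Rem. 27.18 (1)–(4), Prop. 27.15; Rem. 17.14, (17.3).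
* [Kottwitz1992] R. E. Kottwitz, *Points on some Shimura varieties over finite fields*, JAMS 5 (1992): §5 p. 390 (the determinant condition on `Lie(A)`).
* [EGAIV4] A. Grothendieck, J. Dieudonné, *EGA IV₄* (1967): (17.2.3), (16.9.8).
* [Shimura1998] G. Shimura, *Abelian Varieties with Complex Multiplication and Modular Functions* (1998): §3.2 (the representation on invariant differentials ∕ its transpose).
-/

set_option autoImplicit false

noncomputable section

open CategoryTheory AlgebraicGeometry TopologicalSpace Opposite Polynomial
open Literature.RingTheory.Smooth

universe u

namespace Literature.AlgebraicGeometry.Morphisms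

open ChartRing

variable {R : Type u} [CommRing R] [IsLocalRing R] {X : Scheme.{u}} (f : X ⟶ Spec (.of R)) (e : Spec (.of R) ⟶ X) (he : e ≫ f = 𝟙 _)
  (n : ℕ) [SmoothOfRelativeDimension n f]

/-! ## §1 The chosen standard-smooth chart of the section -/

/-- **A chosen standard-smooth affine chart of the whole section** over a local base (choice from ★ `exists_chart_isStandardSmoothOfRelativeDimension`).
[cite: GortzWedhorn2023, Rem. 27.18 (4) and (17.3)] -/
def sectionStdChart : X.Opens :=
  (exists_chart_isStandardSmoothOfRelativeDimension f e he n).choose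

/-- The chosen chart is affine. [cite: GortzWedhorn2023, (17.3)] -/
theorem isAffineOpen_sectionStdChart : IsAffineOpen (sectionStdChart f e he n) :=
  (exists_chart_isStandardSmoothOfRelativeDimension f e he n).choose_spec.1

/-- The chosen chart contains the whole section: `e⁻¹W = ⊤`. [cite: GortzWedhorn2023, Rem. 27.18 (4)] -/
theorem preimage_sectionStdChart_eq_top : e ⁻¹ᵁ sectionStdChart f e he n = ⊤ :=
  (exists_chart_isStandardSmoothOfRelativeDimension f e he n).choose_spec.2.choose

/-- `Γ(X, W)` of the chosen chart is a standard-smooth `R`-algebra of relative dimension `n`. [cite: GortzWedhorn2023, Prop. 27.15] -/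
theorem isStandardSmoothOfRelativeDimension_chartRing_sectionStdChart :
    Algebra.IsStandardSmoothOfRelativeDimension n R (ChartRing f (sectionStdChart f e he n)) :=
  (exists_chart_isStandardSmoothOfRelativeDimension f e he n).choose_spec.2.choose_spec

/-! ## §2 The cotangent space along the section and its dual `Lie` -/

/-- **THE COTANGENT SPACE ALONG THE SECTION, `ω`**: the conormal module `I∕I²` of the section on the CHOSEN standard-smooth chart (★ `sectionAug`, `augIdeal`, Mathlib
`Ideal.Cotangent`) — the affine model of `e^*Ω¹_{X∕R}` of [GortzWedhorn2023] (17.3) ∕ Rem. 27.18 (4) (that identification is print's, not re-proved here).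
[cite: GortzWedhorn2023, Rem. 27.18 (4) and (17.3)] [cite: EGAIV4, (16.9.8)] -/
abbrev SectionCotangent : Type u :=
  (augIdeal (sectionAug f e he (preimage_sectionStdChart_eq_top f e he n))).Cotangent

/-- `ω` is a free `R`-module. [cite: GortzWedhorn2023, Prop. 27.15 and Rem. 27.18 (4)] -/
theorem free_sectionCotangent : Module.Free R (SectionCotangent f e he n) :=
  haveI := isStandardSmoothOfRelativeDimension_chartRing_sectionStdChart f e he n
  free_cotangent_sectionAug_of_isStandardSmooth f e he (preimage_sectionStdChart_eq_top f e he n) n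

/-- `ω` is a finite `R`-module. [cite: GortzWedhorn2023, Prop. 27.15] -/
theorem finite_sectionCotangent : Module.Finite R (SectionCotangent f e he n) :=
  haveI := isStandardSmoothOfRelativeDimension_chartRing_sectionStdChart f e he n
  finite_cotangent_sectionAug_of_isStandardSmooth f e he (preimage_sectionStdChart_eq_top f e he n) n

/-- **`rank_R ω = n`** (the relative dimension). [cite: GortzWedhorn2023, Prop. 27.15 and Rem. 27.18 (4)] [cite: EGAIV4, (17.2.3)] -/
theorem finrank_sectionCotangent : Module.finrank R (SectionCotangent f e he n) = n :=
  haveI := isStandardSmoothOfRelativeDimension_chartRing_sectionStdChart f e he n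
  finrank_cotangent_sectionAug_eq_of_isStandardSmooth f e he (preimage_sectionStdChart_eq_top f e he n) n

/-- **`Lie`, the `R`-dual of `ω`** (Mathlib `Module.Dual`) — the chart model of [GortzWedhorn2023] Def. 27.17 `Lie(G) = T_e(G∕S) = (e^*Ω¹_{G∕S})ᵛ`; only the MODULE is recorded
(no bracket). [cite: GortzWedhorn2023, Def. 27.17 and Rem. 27.18] -/
abbrev SectionLie : Type u := Module.Dual R (SectionCotangent f e he n)

/-- `Lie` is a free `R`-module. [cite: GortzWedhorn2023, Prop. 27.15] -/
theorem free_sectionLie : Module.Free R (SectionLie f e he n) :=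
  haveI := free_sectionCotangent f e he n
  haveI := finite_sectionCotangent f e he n
  inferInstance

/-- `Lie` is a finite `R`-module. [cite: GortzWedhorn2023, Prop. 27.15] -/
theorem finite_sectionLie : Module.Finite R (SectionLie f e he n) :=
  haveI := free_sectionCotangent f e he n
  haveI := finite_sectionCotangent f e he n
  inferInstance

/-- **`rank_R Lie = n`**. [cite: GortzWedhorn2023, Prop. 27.15 and Rem. 27.18 (4)] -/
theorem finrank_sectionLie : Module.finrank R (SectionLie f e he n) = n := by
  haveI := free_sectionCotangent f e he n
  haveI := finite_sectionCotangent f e he n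
  rw [← (Module.Free.chooseBasis R (SectionCotangent f e he n)).toDualEquiv.finrank_eq]
  exact finrank_sectionCotangent f e he n

/-! ### Any affine chart of the section over a local base (★ D2c-i transport) -/

section AnyChart

variable {W : X.Opens} (heW : e ⁻¹ᵁ W = ⊤) (hW : IsAffineOpen W)

include hW in
/-- A shrinking element of a chart `W` whose basic open lies in the chosen standard chart exists. [cite: GortzWedhorn2023, (17.3)] -/
theorem exists_shrink_to_sectionStdChart :
    ∃ k : ChartRing f W, sectionAug f e he heW k = 1 ∧ X.basicOpen (val k) ≤ (𝟙 X) ⁻¹ᵁ sectionStdChart f e he n :=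
  exists_sectionAug_eq_one_and_basicOpen_le f e he heW hW _ (preimage_sectionStdChart_eq_top f e he n)

include heW in
/-- A shrinking element of the chosen standard chart whose basic open lies in `W` exists. [cite: GortzWedhorn2023, (17.3)] -/
theorem exists_shrink_from_sectionStdChart :
    ∃ k : ChartRing f (sectionStdChart f e he n), sectionAug f e he (preimage_sectionStdChart_eq_top f e he n) k = 1 ∧ X.basicOpen (val k) ≤ (𝟙 X) ⁻¹ᵁ W :=
  exists_sectionAug_eq_one_and_basicOpen_le f e he (preimage_sectionStdChart_eq_top f e he n) (isAffineOpen_sectionStdChart f e he n) _ heW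

include n hW in
/-- **OVER A LOCAL BASE, `I∕I²` IS FREE ON EVERY AFFINE CHART OF THE SECTION** (not only on the chosen standard-smooth one): transport along the bijective comparison map of ★ (D2c-i)
`free_cotangent_sectionAug_of_chart`. This is what lets the chart-local Kottwitz condition quantify over ALL affine charts. [cite: GortzWedhorn2023, Prop. 27.15 and (17.3)] -/
theorem free_cotangent_sectionAug_of_isLocalRing : Module.Free R (augIdeal (sectionAug f e he heW)).Cotangent := by
  obtain ⟨k₁, hhk₁, hk₁⟩ := exists_shrink_to_sectionStdChart f e he n heW hW
  obtain ⟨k₂, hhk₂, hk₂⟩ := exists_shrink_from_sectionStdChart f e he n heW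
  haveI := free_sectionCotangent f e he n
  exact free_cotangent_sectionAug_of_chart f e he heW (preimage_sectionStdChart_eq_top f e he n) hW (isAffineOpen_sectionStdChart f e he n) k₁ hk₁ hhk₁ k₂ hk₂ hhk₂

include n hW in
/-- Over a local base, `I∕I²` is a finite `R`-module on every affine chart of the section. [cite: GortzWedhorn2023, Prop. 27.15 and (17.3)] -/
theorem finite_cotangent_sectionAug_of_isLocalRing : Module.Finite R (augIdeal (sectionAug f e he heW)).Cotangent := by
  obtain ⟨k₁, hhk₁, hk₁⟩ := exists_shrink_to_sectionStdChart f e he n heW hW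
  obtain ⟨k₂, hhk₂, hk₂⟩ := exists_shrink_from_sectionStdChart f e he n heW
  haveI := finite_sectionCotangent f e he n
  exact finite_cotangent_sectionAug_of_chart f e he heW (preimage_sectionStdChart_eq_top f e he n) hW (isAffineOpen_sectionStdChart f e he n) k₁ hk₁ hhk₁ k₂ hk₂ hhk₂

include hW in
/-- **Over a local base, `rank_R (I∕I²) = n` on every affine chart of the section.** [cite: GortzWedhorn2023, Prop. 27.15 and (17.3)] [cite: EGAIV4, (17.2.3)] -/
theorem finrank_cotangent_sectionAug_of_isLocalRing : Module.finrank R (augIdeal (sectionAug f e he heW)).Cotangent = n := by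
  obtain ⟨k₁, hhk₁, hk₁⟩ := exists_shrink_to_sectionStdChart f e he n heW hW
  obtain ⟨k₂, hhk₂, hk₂⟩ := exists_shrink_from_sectionStdChart f e he n heW
  rw [← finrank_sectionCotangent f e he n,
    ← (LinearEquiv.ofBijective _ (sectionConormalHom_id_bijective f e he heW (preimage_sectionStdChart_eq_top f e he n) hW (isAffineOpen_sectionStdChart f e he n)
      k₁ hk₁ hhk₁ k₂ hk₂ hhk₂)).finrank_eq]

end AnyChart

/-! ## §3 The action of an endomorphism fixing the section -/

section Endo

variable (v : X ⟶ X) (hv : v ≫ f = f) (hev : e ≫ v = e)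

include hev in
/-- The section lands in `W ∩ v⁻¹W` for the chosen chart `W`. [cite: GortzWedhorn2023, Rem. 17.14] -/
theorem preimage_sectionStdChart_inf_eq_top : e ⁻¹ᵁ (sectionStdChart f e he n ⊓ v ⁻¹ᵁ sectionStdChart f e he n) = ⊤ := by
  rw [Scheme.Hom.preimage_inf, ← Scheme.Hom.comp_preimage, hev, preimage_sectionStdChart_eq_top, inf_idem]

include hev in
/-- A basic open `D(h) ⊆ W ∩ v⁻¹W` of the chosen chart containing the section (`e^♯ h = 1`) exists (★ `exists_sectionAug_eq_one_and_basicOpen_le`). [cite: GortzWedhorn2023, Rem. 17.14 and (17.3)] -/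
theorem exists_shrink_sectionStdChart :
    ∃ h : ChartRing f (sectionStdChart f e he n), sectionAug f e he (preimage_sectionStdChart_eq_top f e he n) h = 1 ∧
      X.basicOpen (val h) ≤ v ⁻¹ᵁ sectionStdChart f e he n := by
  obtain ⟨h, hh, hle⟩ := exists_sectionAug_eq_one_and_basicOpen_le f e he (preimage_sectionStdChart_eq_top f e he n)
    (isAffineOpen_sectionStdChart f e he n) _ (preimage_sectionStdChart_inf_eq_top f e he n v hev)
  exact ⟨h, hh, hle.trans inf_le_right⟩

/-- **THE COTANGENT MAP `v^* = γ_v : ω → ω` OF AN ENDOMORPHISM `v` FIXING THE SECTION**: ★ `sectionConormalEndo` on the chosen chart through a CHOSEN basic open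
`D(h) ⊆ W ∩ v⁻¹W` ∋ the section — the choices are fixed once here so that every `v` acts on ONE carrier `ω` (which `LinearMap.charpoly` needs). [cite: GortzWedhorn2023, Rem. 17.14] -/
def sectionCotangentMap : SectionCotangent f e he n →ₗ[R] SectionCotangent f e he n :=
  sectionConormalEndo f e he (preimage_sectionStdChart_eq_top f e he n) v hv hev (exists_shrink_sectionStdChart f e he n v hev).choose
    (exists_shrink_sectionStdChart f e he n v hev).choose_spec.2 (isAffineOpen_sectionStdChart f e he n) (exists_shrink_sectionStdChart f e he n v hev).choose_spec.1

/-- Unfolding: `sectionCotangentMap` IS ★ `sectionConormalEndo` at the chosen `(W, h)` — so the fibre comparison ★ `Motives.AbelianVariety.charpoly_cotangentMap_eq_map_charpoly`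
and every ★ lemma about `sectionConormalEndo` apply to it verbatim. [cite: GortzWedhorn2023, Rem. 17.14] -/
theorem sectionCotangentMap_def :
    sectionCotangentMap f e he n v hv hev =
      sectionConormalEndo f e he (preimage_sectionStdChart_eq_top f e he n) v hv hev (exists_shrink_sectionStdChart f e he n v hev).choose
        (exists_shrink_sectionStdChart f e he n v hev).choose_spec.2 (isAffineOpen_sectionStdChart f e he n) (exists_shrink_sectionStdChart f e he n v hev).choose_spec.1 :=
  rfl

/-- **THE TANGENT MAP `Lie(v) : Lie → Lie`** — the transpose of `v^*` on `ω` ([GortzWedhorn2023] Rem. 27.18 (1)). [cite: GortzWedhorn2023, Rem. 27.18 (1)] -/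
def sectionLieMap : SectionLie f e he n →ₗ[R] SectionLie f e he n :=
  (sectionCotangentMap f e he n v hv hev).dualMap

/-- `Lie(v) φ = φ ∘ v^*`. [cite: GortzWedhorn2023, Rem. 27.18 (1)] -/
theorem sectionLieMap_apply (φ : SectionLie f e he n) (x : SectionCotangent f e he n) :
    sectionLieMap f e he n v hv hev φ x = φ (sectionCotangentMap f e he n v hv hev x) :=
  rfl

end Endo

/-! ### The identity acts as the identity -/

/-- **`(𝟙)^* = id` on `ω`**. [cite: GortzWedhorn2023, Rem. 17.14] -/
theorem sectionCotangentMap_id : sectionCotangentMap f e he n (𝟙 X) (Category.id_comp f) (Category.comp_id e) = LinearMap.id := by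
  rw [sectionCotangentMap_def]
  exact sectionConormalEndo_id f e he (preimage_sectionStdChart_eq_top f e he n) (isAffineOpen_sectionStdChart f e he n) _ _ _

/-- **`Lie(𝟙) = id`**. [cite: GortzWedhorn2023, Rem. 27.18 (1)] -/
theorem sectionLieMap_id : sectionLieMap f e he n (𝟙 X) (Category.id_comp f) (Category.comp_id e) = LinearMap.id := by
  rw [sectionLieMap, sectionCotangentMap_id, LinearMap.dualMap_id]

/-! ## §4 The characteristic polynomial and the three socket clauses -/

section Charpoly

variable (v : X ⟶ X) (hv : v ≫ f = f) (hev : e ≫ v = e)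

/-- **THE CHARACTERISTIC POLYNOMIAL `char(T, v^* | ω) ∈ R[T]`** of an endomorphism `v` fixing the section, on the free rank-`n` module `ω = e^*Ω¹` (Mathlib `LinearMap.charpoly`);
equal to `char(T, Lie(v) | Lie)` (`charpoly_sectionLieMap`). This is the polynomial the Kottwitz determinant condition reads ([Kottwitz1992] §5 p. 390 «`det(T − i(b) | Lie A)`»).
[cite: Kottwitz1992, §5 p. 390] [cite: GortzWedhorn2023, Rem. 27.18 (1)] -/
def sectionCotangentCharpoly : R[X] :=
  haveI := free_sectionCotangent f e he n
  haveI := finite_sectionCotangent f e he n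
  (sectionCotangentMap f e he n v hv hev).charpoly

/-- Unfolding (for any `Module.Free`∕`Module.Finite` instances the caller holds — both are `Prop`s). [cite: Kottwitz1992, §5 p. 390] -/
theorem sectionCotangentCharpoly_eq [Module.Free R (SectionCotangent f e he n)] [Module.Finite R (SectionCotangent f e he n)] :
    sectionCotangentCharpoly f e he n v hv hev = (sectionCotangentMap f e he n v hv hev).charpoly :=
  rfl

/-- **CLAUSE 1: `char(T, v^* | ω)` IS MONIC.** [cite: Kottwitz1992, §5 p. 390] -/
theorem monic_sectionCotangentCharpoly : (sectionCotangentCharpoly f e he n v hv hev).Monic :=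
  haveI := free_sectionCotangent f e he n
  haveI := finite_sectionCotangent f e he n
  LinearMap.charpoly_monic _

/-- **CLAUSE 2: `deg char(T, v^* | ω) = n`** (the relative dimension). [cite: Kottwitz1992, §5 p. 390] [cite: GortzWedhorn2023, Prop. 27.15] -/
theorem natDegree_sectionCotangentCharpoly : (sectionCotangentCharpoly f e he n v hv hev).natDegree = n := by
  haveI := free_sectionCotangent f e he n
  haveI := finite_sectionCotangent f e he n
  rw [sectionCotangentCharpoly, LinearMap.charpoly_natDegree, finrank_sectionCotangent]

/-- **The Lie side has the same characteristic polynomial** (transpose: dual basis, Mathlib `LinearMap.toMatrix_transpose`, `Matrix.charpoly_transpose` — as in the tree's field case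
★ `Motives.AbelianVariety.charpoly_lieMap`). [cite: GortzWedhorn2023, Rem. 27.18 (1)] [cite: Shimura1998, §3.2] -/
theorem charpoly_sectionLieMap [Module.Free R (SectionLie f e he n)] [Module.Finite R (SectionLie f e he n)] :
    (sectionLieMap f e he n v hv hev).charpoly = sectionCotangentCharpoly f e he n v hv hev := by
  classical
  haveI := free_sectionCotangent f e he n
  haveI := finite_sectionCotangent f e he n
  let b := Module.Free.chooseBasis R (SectionCotangent f e he n)
  rw [sectionCotangentCharpoly, ← LinearMap.charpoly_toMatrix (sectionCotangentMap f e he n v hv hev) b,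
    ← LinearMap.charpoly_toMatrix (sectionLieMap f e he n v hv hev) b.dualBasis, sectionLieMap, LinearMap.dualMap_def, LinearMap.toMatrix_transpose,
    Matrix.charpoly_transpose]

end Charpoly

/-- **CLAUSE 3: `char(T, 𝟙 | ω) = (T − 1)^n`.** [cite: Kottwitz1992, §5 p. 390] [cite: GortzWedhorn2023, Rem. 27.18 (1)] -/
theorem sectionCotangentCharpoly_id :
    sectionCotangentCharpoly f e he n (𝟙 X) (Category.id_comp f) (Category.comp_id e) = (Polynomial.X - C 1) ^ n := by
  haveI := free_sectionCotangent f e he n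
  haveI := finite_sectionCotangent f e he n
  rw [sectionCotangentCharpoly, sectionCotangentMap_id, map_one]
  have h1 : (LinearMap.id : SectionCotangent f e he n →ₗ[R] SectionCotangent f e he n) = 1 := rfl
  rw [h1, LinearMap.charpoly_one, finrank_sectionCotangent]

/-! ## §5 `sectionCotangentCharpoly` is the characteristic polynomial read on ANY affine chart (★ D2c-i chart independence) -/

/-- **CHART INDEPENDENCE**: for ANY affine chart `W` of the section (over the local base) and ANY shrinking element `h` for `v`, the characteristic polynomial of ★ `sectionConormalEndo`
on `I_W∕I_W²` (free and finite by §2b) is `sectionCotangentCharpoly f e he n v hv hev` — so the chosen-chart definition and F0P6a-plan's «∀ chart» typing agree.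
[cite: GortzWedhorn2023, (17.3) and Remark 17.14] [cite: Kottwitz1992, §5 p. 390] -/
theorem charpoly_sectionConormalEndo_eq_sectionCotangentCharpoly {W : X.Opens} (heW : e ⁻¹ᵁ W = ⊤) (hW : IsAffineOpen W)
    [Module.Free R (augIdeal (sectionAug f e he heW)).Cotangent] [Module.Finite R (augIdeal (sectionAug f e he heW)).Cotangent]
    (v : X ⟶ X) (hv : v ≫ f = f) (hev : e ≫ v = e) (h : ChartRing f W) (hhv : X.basicOpen (val h) ≤ v ⁻¹ᵁ W) (hh : sectionAug f e he heW h = 1) :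
    (sectionConormalEndo f e he heW v hv hev h hhv hW hh).charpoly = sectionCotangentCharpoly f e he n v hv hev := by
  haveI := free_sectionCotangent f e he n
  haveI := finite_sectionCotangent f e he n
  obtain ⟨k₁, hhk₁, hk₁⟩ := exists_shrink_to_sectionStdChart f e he n heW hW
  obtain ⟨k₂, hhk₂, hk₂⟩ := exists_shrink_from_sectionStdChart f e he n heW
  rw [sectionCotangentCharpoly_eq, sectionCotangentMap_def]
  exact charpoly_sectionConormalEndo_eq_of_charts f e he heW (preimage_sectionStdChart_eq_top f e he n) hW (isAffineOpen_sectionStdChart f e he n)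
    k₁ hk₁ hhk₁ k₂ hk₂ hhk₂ v hv hev h hhv hh _ _ _

/-- In particular `sectionCotangentCharpoly` does not depend on the shrinking element chosen in `sectionCotangentMap` (★ `sectionConormalEndo_eq_of_shrink`). [cite: GortzWedhorn2023, (17.3)] -/
theorem sectionCotangentCharpoly_eq_charpoly_sectionConormalEndo_sectionStdChart (v : X ⟶ X) (hv : v ≫ f = f) (hev : e ≫ v = e)
    (h : ChartRing f (sectionStdChart f e he n)) (hhv : X.basicOpen (val h) ≤ v ⁻¹ᵁ sectionStdChart f e he n)
    (hh : sectionAug f e he (preimage_sectionStdChart_eq_top f e he n) h = 1) :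
    sectionCotangentCharpoly f e he n v hv hev =
      (haveI := free_sectionCotangent f e he n; haveI := finite_sectionCotangent f e he n;
        (sectionConormalEndo f e he (preimage_sectionStdChart_eq_top f e he n) v hv hev h hhv (isAffineOpen_sectionStdChart f e he n) hh).charpoly) := by
  haveI := free_sectionCotangent f e he n
  haveI := finite_sectionCotangent f e he n
  exact (charpoly_sectionConormalEndo_eq_sectionCotangentCharpoly f e he n (preimage_sectionStdChart_eq_top f e he n) (isAffineOpen_sectionStdChart f e he n)
    v hv hev h hhv hh).symm

end Literature.AlgebraicGeometry.Morphisms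

end
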